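import Summits.Schanuel.Schanuel.Theorems.SoloInformedAE32GelfondInput
import Summits.Schanuel.Schanuel.Theorems.SoloInformedAE32Eventually
import Summits.Schanuel.Schanuel.Theorems.SoloInformedTheoremAE3

/-!
# Theorem AE₃-2 (η = 0): `ν > β + 2(1 − σ − τ)` is an exponent — conditionally on [Roy2010]

Soloist file (informed mode, seat `solo-Schanuel-informed`, s182).  The kernel form of the
seat's THEOREM AE₃-2 (`paper/AE-note.md` §14; `work/s182/AE3-note.md` §4), the 3-term-AP form
of THEOREM AE-2 (`soloA2_Ioi_subset_royAdditiveSVEExponents`, threshold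
`β + (5/2)(1 − σ − τ)` on `5σ + 3τ > 3`) on the node `RoyAdditiveDirichletExponent`
([cite: Roy2010, Thm 1.1]; Roy's question there is whether every `ν > 1 + β − σ − τ` is an
exponent), CONDITIONAL on the same two results of [Roy2010] carried as displayed hypotheses —
typed named facts of the Literature tree, not proved there: the pointwise transfer estimate
`(hR1 : cor_3_2)` [cite: Roy2010, Cor 3.2] and the degree/height bound for the gcd of the
prime dilates `(hR2 : thm_1_2)` [cite: Roy2010, Thm 1.2]:

  for `ξ ∈ ℂ` transcendental, `β > 1`, `0 ≤ τ`, `σ + τ < 1`, `2σ + τ > 1`: every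
  `ν > β + 2(1 − σ − τ)` lies in `royAdditiveSVEExponents ξ β σ τ`.

Mechanism (one `n` at a time, `soloA32_gelfond_input`): exactly that of THEOREM AE-2 — prime
dilates `P(aX)`, `a ≤ n^μ`, with derivatives of order `< t ≍ n^τ`; few bad points among `iξ`,
`i ≤ K = ⌊n^{σ-μ}⌋` ([Roy2010, Cor 3.2]); stripping; the dilation gcd of [Roy2010, Thm 1.2]
of degree `≤ N = ⌊n^{1-μ+δ}⌋` and logarithmic height `≤ n^{β-μ+δ}` — except that the rigidity
step at the root-count scale `N` is the 3-term-AP theorem (`soloG3S_structured_roots`, budget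
`K² W ≫ D₀² L₀ + D₀³`) instead of the squared-difference one (`K³ W ≫ D₀³ L₀ + D₀⁴`).  Gel'fond's
criterion (`Literature.NumberTheory.Transcendental.gelfond_criterion_not_small_values`) is run
with `(N+1)^{e₁}`, `(N+1)^{e₂}`, `e₁ = 1 − σ − τ + δ + κ`, `e₂ = β − σ − τ + δ + κ`,
`κ = ε₀/4`, `ε₀ = ν − β − 2(1 − σ − τ) > 0`.  Parameters: `ε₁ = min ε₀ ((2σ + τ − 1)/2)`,
`μ = (1 − σ − τ) + ε₁/2 < σ`, `δ = ε₁/20`; the binding constraints are the rigidity budget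
`ν > 3 + β − 3σ − 3τ − μ + 4δ` (`soloAW_condD`) and the transfer condition
`ν > 1 + β − σ − τ + μ` (`soloAW_condB`), balanced at `μ → 1 − σ − τ`, and `μ < σ` is where
`2σ + τ > 1` enters.  The threshold improves THEOREM AE-2's `β + (5/2)(1 − σ − τ)` and THEOREM
AE₃-1τ's `β + 3(1 − σ − τ)` throughout this range, improves the one-point Gel'fond ceiling
`1 + β` iff `σ + τ > 1/2` (automatic here), improves [Roy2010, (3)] `1 + β − (3/4)σ − τ` iff
`5σ + 4τ > 4`, and tends to Roy's conjectured `1 + β − σ − τ → β` as `σ + τ → 1`.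

What this is NOT.  Conditional on [cite: Roy2010, Cor 3.2] and [cite: Roy2010, Thm 1.2] as
displayed; not the node `RoyAdditiveDirichletExponent`, whose window
`(1 + β − σ − τ, β + 2(1 − σ − τ)]` stays open; the `η > 0` form (with Roy's `δ`-exponent) is
not formalised; and nothing here bears on `Literature.Periods.SchanuelConjecture` (the seat's
verdict, no path, is unchanged).  Tree files and Mathlib only; no definitions; axioms the
standard three.
-/

namespace Summit.Schanuel.Schanuel.Theorems

open Polynomial Finset Filter
open Literature.NumberTheory.Transcendental.Roy2010 (cor_3_2 thm_1_2 primesLe dilationGcd)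

/-- **THEOREM AE₃-2, `η = 0` (kernel form, conditional on [Roy2010, Cor 3.2 and Thm 1.2]).**
For `ξ` transcendental, `β > 1`, `0 ≤ τ`, `σ + τ < 1`, `2σ + τ > 1` (so `σ > 1/3`): every
`ν > β + 2(1 − σ − τ)` is an exponent of Roy's additive small value estimate at the
points `iξ` with derivatives of order `≤ n^τ`, i.e.
`Set.Ioi (β + 2(1 - σ - τ)) ⊆ royAdditiveSVEExponents ξ β σ τ`. -/
theorem soloA32_Ioi_subset_royAdditiveSVEExponents (hR1 : cor_3_2) (hR2 : thm_1_2) {ξ : ℂ}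
    (hξ : Transcendental ℚ ξ) {β σ τ : ℝ} (hβ : 1 < β) (hτ0 : 0 ≤ τ) (hστ : σ + τ < 1)
    (h21 : 1 < 2 * σ + τ) :
    Set.Ioi (β + 2 * (1 - σ - τ)) ⊆ royAdditiveSVEExponents ξ β σ τ := by
  intro ν hν
  rw [Set.mem_Ioi] at hν
  by_contra hcon
  have hev : ∀ᶠ n : ℕ in atTop, (RoyAdditiveSmall ξ β σ τ ν n).Nonempty :=
    (Filter.not_frequently.mp hcon).mono fun n hn => not_not.mp hn
  have hξ0 : ξ ≠ 0 := by
    intro h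
    apply hξ
    rw [h]
    exact isAlgebraic_zero
  have hξpos : 0 < ‖ξ‖ := norm_pos_iff.mpr hξ0
  have hσ1 : σ < 1 := by linarith
  have hu0 : 0 < 1 - σ - τ := by linarith
  have hν1 : 1 < ν := by nlinarith
  -- the constant `c₁` of the served-set lemma
  set c₁ : ℝ := max 0 (Real.log (2 / ‖ξ‖)) with hc₁
  have hc : Real.exp (-c₁) ≤ min 1 (‖ξ‖ / 2) := by
    refine le_min ?_ ?_
    · rw [Real.exp_le_one_iff]
      linarith [le_max_left 0 (Real.log (2 / ‖ξ‖))]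
    · have h2 : 0 < 2 / ‖ξ‖ := by positivity
      calc Real.exp (-c₁) ≤ Real.exp (-Real.log (2 / ‖ξ‖)) :=
            Real.exp_le_exp.mpr (by linarith [le_max_right 0 (Real.log (2 / ‖ξ‖))])
        _ = ‖ξ‖ / 2 := by rw [Real.exp_neg, Real.exp_log h2, inv_div]
  -- the parameters `μ`, `δ` and the exponents of the comparison sequences
  set ε₀ : ℝ := ν - β - 2 * (1 - σ - τ) with hε₀
  have hε₀0 : 0 < ε₀ := by rw [hε₀]; linarith
  set γ : ℝ := (2 * σ + τ - 1) / 2 with hγ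
  have hγ0 : 0 < γ := by rw [hγ]; linarith
  set ε₁ : ℝ := min ε₀ γ with hε₁
  have hε₁0 : 0 < ε₁ := lt_min hε₀0 hγ0
  have hε₁a : ε₁ ≤ ε₀ := min_le_left _ _
  have hε₁b : ε₁ ≤ γ := min_le_right _ _
  set μ : ℝ := (1 - σ - τ) + ε₁ / 2 with hμ
  set δ : ℝ := ε₁ / 20 with hδ
  have hμ0 : 0 < μ := by rw [hμ]; linarith
  have hμσ : μ < σ := by rw [hμ]; linarith
  have hμ1 : μ < 1 := by linarith
  have hδ0 : 0 < δ := by rw [hδ]; linarith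
  have hδμ : δ < μ := by rw [hδ, hμ]; linarith
  have ha0 : 0 < 1 - μ + δ := by linarith
  have ha1 : 1 - μ + δ < ν := by linarith
  have hg : 0 < ν + σ - 1 - δ := by linarith
  have hBud : 1 + β + μ < σ + τ + ν := by rw [hμ]; linarith
  have hD : 2 + β - 3 * μ + 3 * δ - 3 * τ < 3 * σ - 2 * μ + ν - 1 - δ := by
    rw [hμ, hδ]; linarith
  have hE1 : 1 - τ + δ - μ < ν + σ - 1 - δ := by rw [hμ, hδ]; linarith
  have hE2 : β - σ - τ + δ < ν + σ - 1 - δ := by rw [hδ]; linarith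
  set κ : ℝ := ε₀ / 4 with hκ
  have hκ0 : 0 < κ := by rw [hκ]; linarith
  set e₁ : ℝ := 1 - σ - τ + δ + κ with he₁
  set e₂ : ℝ := β - σ - τ + δ + κ with he₂
  have he₁0 : 0 < e₁ := by rw [he₁]; linarith
  have he₂0 : 0 < e₂ := by rw [he₂]; linarith
  have he12 : e₁ ≤ e₂ := by rw [he₁, he₂]; linarith
  have hE : e₁ + e₂ < ν + σ - 1 - δ := by rw [he₁, he₂, hδ, hκ]; linarith
  have hF : 1 - σ - τ + δ < e₁ := by rw [he₁]; linarith
  have hG1 : 1 - σ - τ + δ + κ / 2 < e₂ := by rw [he₂]; linarith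
  have hG2 : β - σ - τ + δ < e₂ := by rw [he₂]; linarith
  have hσμ1 : σ - μ ≤ 1 := by linarith
  set a : ℝ := (2 : ℝ) ^ e₂ + 1 with ha_def
  have h2e₂ : 0 < (2 : ℝ) ^ e₂ := by positivity
  have ha1' : 1 < a := by linarith
  have ha0' : 0 < a := by linarith
  have h2e₁ : (2 : ℝ) ^ e₁ ≤ (2 : ℝ) ^ e₂ :=
    Real.rpow_le_rpow_of_exponent_le (by norm_num) he12
  -- [Roy2010, Thm 1.2] at `(β, δ, μ)`
  obtain ⟨n₀, hn₀⟩ := hR2 β δ μ hδ0 hμ0 hμ1 hβ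
  -- all eventual conditions at once
  have hall := hev.and ((eventually_ge_atTop n₀).and ((soloT3_floor (sub_pos.mpr hμσ)).and
    ((soloAV_tfloor hτ0).and ((soloT1_floor ha0).and ((soloAV_Kt hμ0 hμσ hτ0 hστ).and
    ((soloAV_condV ξ hν1).and ((soloAV_cond1 ha0 ha1 c₁).and
    ((soloAW_cond4 (ν := ν) hμσ ha0 hg).and
    ((soloAV_condA ξ hμ0 hμσ hσ1 (τ := τ) (ν := ν) (by linarith) hν1).and
    ((soloAW_condB hβ hμ0 hμ1.le hμσ hτ0 hBud).and ((soloAW_condD hβ.le hμσ hτ0 ha0 hD).and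
    ((soloAW_condE ξ hβ.le hμσ hτ0 ha0 hE1 hE2).and
    ((soloAV_condF hβ.le hμσ hτ0 ha0 he₁0.le hF).and
    ((soloAV_condG hβ.le hμσ hσμ1 hτ0 ha0 hκ0 he₂0.le hG1 hG2).and
    (soloAW_condH (ν := ν) hμσ ha0 he₁0.le he₂0.le hE ha0')))))))))))))))
  obtain ⟨N₀, hN₀⟩ := Filter.eventually_atTop.mp hall
  -- the Gel'fond inputs `Q n`, `n ≥ N₀` (junk `1` below `N₀`)
  have hex : ∀ n : ℕ, ∃ Q : ℤ[X], N₀ ≤ n →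
      Q ≠ 0 ∧ (Q.natDegree : ℝ) ≤
          20 * (((⌊(n : ℝ) ^ (1 - μ + δ)⌋₊ : ℕ) : ℝ) / ((⌊(n : ℝ) ^ τ / 2⌋₊ + 1 : ℕ) : ℝ)) /
            ⌊(n : ℝ) ^ (σ - μ)⌋₊ ∧
        Q.gelfondType ≤
          20 * (((⌊(n : ℝ) ^ (1 - μ + δ)⌋₊ : ℕ) : ℝ) / ((⌊(n : ℝ) ^ τ / 2⌋₊ + 1 : ℕ) : ℝ)) /
              ⌊(n : ℝ) ^ (σ - μ)⌋₊ * (2 + Real.log ⌊(n : ℝ) ^ (σ - μ)⌋₊) +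
            20 * ((((⌊(n : ℝ) ^ (1 - μ + δ)⌋₊ : ℕ) : ℝ) / 2 + (n : ℝ) ^ (β - μ + δ)) /
              ((⌊(n : ℝ) ^ τ / 2⌋₊ + 1 : ℕ) : ℝ)) / ⌊(n : ℝ) ^ (σ - μ)⌋₊ ∧
        ‖aeval ξ Q‖ ≤ Real.exp (-((n : ℝ) ^ ν / 4 * ⌊(n : ℝ) ^ (σ - μ)⌋₊ /
          (160000 * ⌊(n : ℝ) ^ (1 - μ + δ)⌋₊) / 2)) := by
    intro n
    by_cases h : N₀ ≤ n
    · obtain ⟨hne, hn₀n, ⟨hn1, hK, -, -⟩, ⟨ht1, htτ, -, -⟩, ⟨-, hN1, -, -⟩, ⟨hKt, hKx, hx3⟩,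
        hcV, hc1, hc4, hcA, hcB, hcD, hcE, -, -, -⟩ := hN₀ n h
      have hn : 1 ≤ n := by exact_mod_cast hn1
      have hN : 1 ≤ ⌊(n : ℝ) ^ (1 - μ + δ)⌋₊ := le_trans (by norm_num) hN1
      have hLg : (0 : ℝ) ≤ (n : ℝ) ^ (β - μ + δ) := by positivity
      have hR2n : ∀ G : ℤ[X], G ≠ 0 → G.natDegree ≤ n →
          G.supNorm ≤ Real.exp ((n : ℝ) ^ β) → G.coeff 0 ≠ 0 →
          ((dilationGcd (primesLe ((n : ℝ) ^ μ)) G).natDegree : ℝ) ≤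
              ((⌊(n : ℝ) ^ (1 - μ + δ)⌋₊ : ℕ) : ℝ) ∧
            (dilationGcd (primesLe ((n : ℝ) ^ μ)) G).supNorm ≤
              Real.exp ((n : ℝ) ^ (β - μ + δ)) := by
        intro G hG0 hGdeg hGsup hGc
        obtain ⟨h1, h2⟩ := hn₀ n hn₀n G hG0 hGdeg hGsup hGc
        exact ⟨by exact_mod_cast Nat.le_floor h1, h2⟩
      obtain ⟨Q, hQ⟩ := soloA32_gelfond_input hR1 hξ hn hK hN hx3 hKx ht1 htτ hKt hLg hR2n
        hc hcA hcB hcV hc1 hc4 hcD hcE hne.some_mem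
      exact ⟨Q, fun _ => hQ⟩
    · exact ⟨1, fun h' => absurd h' h⟩
  choose Q hQ using hex
  -- Gel'fond's criterion with `δ_N = (N+1)^{e₁}`, `σ_N = (N+1)^{e₂}`
  obtain ⟨hδm, hδ0', -, hδr⟩ := soloT1_seq he₁0
  obtain ⟨hσm, hσ0', hσt, hσr⟩ := soloT1_seq he₂0
  have hδa : ∀ N : ℕ, (((N + 1 : ℕ) : ℝ) + 1) ^ e₁ ≤ a * (((N : ℝ) + 1) ^ e₁) := fun N => by
    have hp : 0 < ((N : ℝ) + 1) ^ e₁ := hδ0' N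
    calc (((N + 1 : ℕ) : ℝ) + 1) ^ e₁ ≤ (2 : ℝ) ^ e₁ * ((N : ℝ) + 1) ^ e₁ := hδr N
      _ ≤ a * ((N : ℝ) + 1) ^ e₁ := by
          apply mul_le_mul_of_nonneg_right _ hp.le
          linarith
  have hσa : ∀ N : ℕ, (((N + 1 : ℕ) : ℝ) + 1) ^ e₂ < a * (((N : ℝ) + 1) ^ e₂) := fun N => by
    have hp : 0 < ((N : ℝ) + 1) ^ e₂ := hσ0' N
    calc (((N + 1 : ℕ) : ℝ) + 1) ^ e₂ ≤ (2 : ℝ) ^ e₂ * ((N : ℝ) + 1) ^ e₂ := hσr N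
      _ < a * ((N : ℝ) + 1) ^ e₂ := by
          apply mul_lt_mul_of_pos_right _ hp
          linarith
  have hQcrit : ∀ N, N₀ ≤ N → Q N ≠ 0 ∧ ((Q N).natDegree : ℝ) < ((N : ℝ) + 1) ^ e₁ ∧
      (Q N).gelfondType < ((N : ℝ) + 1) ^ e₂ := fun N hN => by
    obtain ⟨hQ0, hQd, hQt, -⟩ := hQ N hN
    obtain ⟨-, -, -, -, -, -, -, -, -, -, -, -, -, hF', hG', -⟩ := hN₀ N hN
    exact ⟨hQ0, hQd.trans_lt hF', hQt.trans_lt hG'⟩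
  obtain ⟨N, hNN₀, hlow⟩ :=
    Literature.NumberTheory.Transcendental.gelfond_criterion_not_small_values hξ a ha1'
      (fun N : ℕ => ((N : ℝ) + 1) ^ e₁) (fun N : ℕ => ((N : ℝ) + 1) ^ e₂) hδm hσm hδ0' hσ0'
      hσt hδa hσa Q N₀ hQcrit
  -- compare the two bounds at this `N`
  obtain ⟨-, -, -, hup⟩ := hQ N hNN₀
  obtain ⟨-, -, -, -, -, -, -, -, -, -, -, -, -, -, -, hH⟩ := hN₀ N hNN₀
  have hfin := Real.exp_le_exp.mp (hlow.trans hup)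
  linarith

end Summit.Schanuel.Schanuel.Theorems
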